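import Literature.AlgebraicGeometry.HodgeTheory.MotivatedClassesDeformationInputs
import Literature.AlgebraicGeometry.HodgeTheory.HyperplaneSectionMonodromySmoothLocus
import Literature.AlgebraicGeometry.Resolution.SmoothOfRegularPerfectField
import Literature.AlgebraicGeometry.Motives.SmoothPiecesByDimension
import Literature.NumberTheory.Transcendental.AnalytificationChartsProofs
import Literature.AlgebraicGeometry.Motives.Varieties
import HarnessLib

/-!
# Smoothness of a `ℂ`-scheme from the regularity of its local rings at complex points

Support file of the algebraisation package `Literature.AlgebraicGeometry.Motives.ProjectiveManifold`
(re-homed verbatim from `Summits/HodgeConjecture/HodgeConjecture/Theorems/SecondaryPeriodsRiemannWeightOneStubAlgebraisationSmoothReduction.lean`,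
route `SecondaryPeriods`, crux `RiemannWeightOne`, where it was first proved; Literature cannot
import Summits; the embedding-free form `smoothOfRelativeDimension_of_forall_isRegularLocalRing` is
added). It reduces `SmoothOfRelativeDimension n X.hom` for a `ℂ`-scheme locally of finite type —
and `IsSmoothProjective n X` for a closed subscheme `ι : X ↪ ℙᴺ_ℂ` — with CONNECTED space of complex
points to two local statements at complex points:

* (reg) every local ring `𝒪_{X,P}`, `P ∈ X(ℂ)`, is a regular local ring;
* (dim) some local ring `𝒪_{X,P}`, `P ∈ X(ℂ)`, has Krull dimension `n`.

Indeed: a regular local ring essentially of finite type over the perfect field `ℂ` is formally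
smooth (Matsumura §30 Rem. 2 / Stacks 00TV, the tree's
`Resolution.formallySmooth_of_isRegularLocalRing_of_perfectField`), so every closed point lies in
Mathlib's open `smoothLocus`, whose closed complement then has no closed point and is empty (`X` is
Jacobson) — `smooth_of_forall_complexPoints_isRegularLocalRing`; a smooth `ℂ`-scheme with connected
complex points is smooth of ONE relative dimension `d` (the tree's
`exists_smoothOfRelativeDimension_of_connectedSpace_complexPoints`) and geometrically irreducible
(`geometricallyIrreducible_of_connectedSpace_complexPoints`); and `d = dim 𝒪_{X,P} = n` at a
rational point of a standard smooth chart (`ringKrullDim_stalk_eq_of_isStandardSmoothOfRelativeDimension`).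

* `mem_smoothLocus_of_isRegularLocalRing` — pointwise form of the tree's
  `smooth_of_isRegular_of_perfectField`;
* `smooth_of_forall_complexPoints_isRegularLocalRing`;
* `smoothOfRelativeDimension_of_forall_isRegularLocalRing` — the embedding-free reduction;
* `isSmoothProjective_of_forall_isRegularLocalRing` — **the reduction** for `X ⊆ ℙᴺ_ℂ`.

## References

* [Matsumura1987] H. Matsumura, Commutative Ring Theory, §30 Remark 2 after Thm. 30.3.
* [StacksProject] Tags 00TV, 056S, 01TB.
* [GortzWedhorn2020] U. Görtz, T. Wedhorn, Algebraic Geometry I, Thm. 6.28, Lemma 6.26.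
* [SerreGAGA1956] J.-P. Serre, GAGA, §2 n°6 Prop. 3 and Cor.
-/

noncomputable section


namespace Literature.AlgebraicGeometry.Motives.ProjectiveManifold

open CategoryTheory _root_.AlgebraicGeometry TopologicalSpace
open Literature.AlgebraicGeometry.Motives

universe u

/-! ### Regular local ring at a point ⇒ smooth point (perfect base field) -/

/-- **A point with regular local ring is a smooth point**, for a scheme locally of finite type over
a perfect field `k` (Stacks 00TV: a regular local ring essentially of finite type over a perfect
field is formally smooth; the stalk of `Spec k` is a localisation of `k`, hence formally étale over
`k`). Pointwise form of the tree's `Resolution.smooth_of_isRegular_of_perfectField`.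
[cite: Matsumura1987, §30 Remark 2 after Thm. 30.3] [cite: StacksProject, Tag 00TV] -/
theorem mem_smoothLocus_of_isRegularLocalRing {k : Type u} [Field k] [PerfectField k]
    {Y : Scheme.{u}} (f : Y ⟶ Spec (CommRingCat.of k)) [LocallyOfFiniteType f] (x : Y)
    (hx : IsRegularLocalRing (Y.presheaf.stalk x)) : x ∈ f.smoothLocus := by
  -- adapted from `Literature.AlgebraicGeometry.Resolution.smooth_of_isRegular_of_perfectField`
  rw [Scheme.Hom.mem_smoothLocus]
  let R := (Spec (CommRingCat.of k)).presheaf.stalk (f.base x)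
  let S := Y.presheaf.stalk x
  letI algRS : Algebra R S := (f.stalkMap x).hom.toAlgebra
  letI algkR : Algebra k R := StructureSheaf.stalkAlgebra (↑(CommRingCat.of k)) (f.base x)
  haveI : IsLocalization.AtPrime R (f.base x).asIdeal :=
    StructureSheaf.IsLocalization.to_stalk (↑(CommRingCat.of k)) (f.base x)
  haveI : Algebra.FormallyEtale k R := Algebra.FormallyEtale.of_isLocalization (f.base x).asIdeal.primeCompl
  haveI : Algebra.EssFiniteType k R :=
    Algebra.EssFiniteType.of_isLocalization R (f.base x).asIdeal.primeCompl
  letI algkS : Algebra k S := ((algebraMap R S).comp (algebraMap k R)).toAlgebra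
  haveI : IsScalarTower k R S := IsScalarTower.of_algebraMap_eq' rfl
  haveI : Algebra.EssFiniteType R S := LocallyOfFiniteType.stalkMap f x
  haveI : Algebra.EssFiniteType k S := Algebra.EssFiniteType.comp k R S
  haveI : IsRegularLocalRing S := hx
  have hkS : Algebra.FormallySmooth k S :=
    Literature.AlgebraicGeometry.Resolution.formallySmooth_of_isRegularLocalRing_of_perfectField k S
  exact (Algebra.FormallySmooth.iff_restrictScalars (R := k) (A := R) (B := S)).mp hkS

/-- **Regular local rings at all complex points ⇒ smooth over `ℂ`**, for `X` locally of finite type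
over `ℂ`: the complex points are the closed points (Nullstellensatz), they lie in the open smooth
locus (`mem_smoothLocus_of_isRegularLocalRing`), whose closed complement therefore contains no
closed point and is empty, `X` being Jacobson. [cite: StacksProject, Tag 00TV] [cite: GortzWedhorn2020, Thm. 6.28] -/
theorem smooth_of_forall_complexPoints_isRegularLocalRing {X : SchemeOver ℂ} [LocallyOfFiniteType X.hom]
    (hreg : ∀ P : ComplexPoints X, IsRegularLocalRing (X.left.presheaf.stalk P.pt)) :
    Smooth X.hom := by
  rw [← Scheme.Hom.smoothLocus_eq_top_iff]
  haveI := ComplexPoints.jacobsonSpace_left (X := X)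
  -- the closed complement of the smooth locus has no closed point
  by_contra hne
  have hne' : ((X.hom.smoothLocus : Set X.left)ᶜ).Nonempty := by
    by_contra h
    rw [Set.not_nonempty_iff_eq_empty, Set.compl_empty_iff] at h
    exact hne (Opens.ext h)
  obtain ⟨y, hy, hyc⟩ := nonempty_inter_closedPoints hne'
    X.hom.smoothLocus.isOpen.isClosed_compl.isLocallyClosed
  rw [← ComplexPoints.range_pt] at hyc
  obtain ⟨P, rfl⟩ := hyc
  exact hy (mem_smoothLocus_of_isRegularLocalRing X.hom P.pt (hreg P))

/-! ### The reduction -/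

/-- **Smoothness of relative dimension `n` from the local rings at complex points** (no projective
embedding needed). Let `X` be a `ℂ`-scheme locally of finite type whose space of complex points
`X(ℂ)` is connected, all of whose local rings at complex points are regular, one of them of
dimension `n`. Then `X → Spec ℂ` is smooth of relative dimension `n`: smooth
(`smooth_of_forall_complexPoints_isRegularLocalRing`), hence smooth of one relative dimension `d`
(`X(ℂ)` connected, `exists_smoothOfRelativeDimension_of_connectedSpace_complexPoints`), with
`d = dim 𝒪_{X,P} = n` (`ringKrullDim_stalk_eq_of_isStandardSmoothOfRelativeDimension`).
[cite: StacksProject, Tag 00TV] [cite: GortzWedhorn2020, Thm. 6.28 and Lemma 6.26] -/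
theorem smoothOfRelativeDimension_of_forall_isRegularLocalRing {n : ℕ} {X : SchemeOver ℂ}
    [LocallyOfFiniteType X.hom] [ConnectedSpace (ComplexPoints X)]
    (hreg : ∀ P : ComplexPoints X, IsRegularLocalRing (X.left.presheaf.stalk P.pt))
    (hdim : ∃ P : ComplexPoints X, ringKrullDim (X.left.presheaf.stalk P.pt) = n) :
    SmoothOfRelativeDimension n X.hom := by
  haveI : Smooth X.hom := smooth_of_forall_complexPoints_isRegularLocalRing hreg
  obtain ⟨d, hd⟩ :=
    Literature.AlgebraicGeometry.HodgeTheory.exists_smoothOfRelativeDimension_of_connectedSpace_complexPoints X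
  haveI := hd
  -- `d = n`
  obtain ⟨P, hP⟩ := hdim
  obtain ⟨V, hV, hPV, hsm⟩ := AlgPoints.exists_isStandardSmoothOfRelativeDimension_scalarRingHom d P
  have hd' := ringKrullDim_stalk_eq_of_isStandardSmoothOfRelativeDimension hV hsm P hPV
  rw [hP] at hd'
  have hdn : d = n := by exact_mod_cast hd'.symm
  subst hdn
  exact hd

/-- **Reduction of `IsSmoothProjective n X` to the local rings at complex points.** A closed
subscheme `ι : X ↪ ℙᴺ_ℂ` with connected `X(ℂ)`, all of whose local rings at complex points are
regular and one of which has dimension `n`, is smooth projective of dimension `n` and geometrically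
irreducible: `smoothOfRelativeDimension_of_forall_isRegularLocalRing` (finite type from properness),
geometric irreducibility from the connectedness of `X(ℂ)`
(`geometricallyIrreducible_of_connectedSpace_complexPoints`); projective by `ι`.
[cite: SerreGAGA1956, §2 n°6 Prop. 3 and Cor. 2] [cite: GortzWedhorn2020, Thm. 6.28 and Lemma 6.26] -/
theorem isSmoothProjective_of_forall_isRegularLocalRing {n N : ℕ} {X : SchemeOver ℂ}
    (ι : X ⟶ projectiveSpace N ℂ) [IsClosedImmersion ι.left] [ConnectedSpace (ComplexPoints X)]
    (hreg : ∀ P : ComplexPoints X, IsRegularLocalRing (X.left.presheaf.stalk P.pt))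
    (hdim : ∃ P : ComplexPoints X, ringKrullDim (X.left.presheaf.stalk P.pt) = n) :
    IsSmoothProjective n X := by
  haveI : IsProper X.hom := by rw [← Over.w ι]; infer_instance
  haveI : LocallyOfFiniteType X.hom := inferInstance
  haveI := smoothOfRelativeDimension_of_forall_isRegularLocalRing (n := n) hreg hdim
  exact ⟨this, ⟨N, ι, inferInstance⟩, geometricallyIrreducible_of_connectedSpace_complexPoints n⟩

end Literature.AlgebraicGeometry.Motives.ProjectiveManifold

end
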